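import Summits.HodgeConjecture.CorCM.QuarticCMReflexInOcticHodge
import Literature.NumberTheory.ComplexMultiplication.DihedralOcticNoPrimitiveType
import HarnessLib

/-!
# A simple CM abelian surface of dihedral type times a simple CM abelian fourfold whose field contains the surface's
# field or its reflex field: the two criteria WITHOUT the "`K_F` not Galois" proviso

COR-CM (cell `pub-hodgecm2`, binder seat `b16` gen 40, count-neutral claim SxF-ONECONJ (F6)); NEW as stated, hence under
`Summits/`.  Theorems only; no definition, no named fact, no `sorry`.

`QuarticCMSubfieldOfOcticHodge` (F4) and `QuarticCMReflexInOcticHodge` (F5) decide the pair `(K_S; Φ_S)`, `(K_F; Φ_F)` —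
`K_S` a NON-Galois quartic CM field, `K_F` an octic CM field containing `K_S` resp. the other quartic class `M` of the
Galois closure `L_S` — under the proviso that `K_F` is not Galois.  A Galois `K_F` receiving `K_S` (or `M`) is the
dihedral closure `L_S` itself, which carries NO nondegenerate CM type (`DihedralOcticNoPrimitiveType`, this seat: a
`16`-case check in `D₄`); in that case both sides of the criteria fail.  Hence the proviso can be dropped:

* **`isNondegenerateFamily_iff_of_quarticSubfield'`** — `K_S` non-Galois quartic, `K_S ↪ K_F` octic: for EVERY pair of
  types, `(Φ_S, Φ_F)` is nondegenerate iff `Φ_F` is;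
* **`isNondegenerateFamily_iff_of_reflexSubfield'`** — `M ↪ K_F` (`M` the other quartic class of `L_S`), `ψ₀ : M → ℂ`
  unsplit for `Φ_F`: nondegenerate iff `Φ_F` is nondegenerate and some automorphism of `ℂ` fixing `ψ₀` moves `Φ_S`;
* on the varieties (`S`, `F` SIMPLE realisations): **`forall_prod_hodgeClassSpan_eq_iff_surface_fourfold_of_subfield`**,
  **`forall_prod_hodgeClassSpan_eq_iff_surface_fourfold_of_reflexSubfield`** (`B• = D•` on ALL `S^a × F^b` iff …), and the
  Hodge conjecture on every `S^a × F^b` in the nondegenerate cases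
  (`hodgeConjectureFor_prod_surface_fourfold_of_subfield`, `…_of_reflexSubfield`).

With `CyclicCMSurfaceTimesCMHodge` (cyclic `K_S`: nondegenerate iff `Φ_F` is and `K_S ⊄ K_F`),
`GaloisClosureMeetsOneConjugateHodge` (`L_S ∩ y₀(K_F)` totally real) and `SimpleCMSurfaceTimesCMHodge` (`L_S ⊄ L_F`) this
is the census of the `(2, 4)` partition of dimension `6`: the reflex configuration is the only one decided by the types.

## References

* [MoonenZarhin1999LowDim] B. Moonen, Yu. Zarhin, *Hodge classes on abelian varieties of low dimension*, Math. Ann.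
  315 (1999), Thm. (0.2) and "Hodge groups of simple abelian surfaces of CM-type".
* [Gordon1999HodgeAVSurvey] B. B. Gordon, *A survey of the Hodge conjecture for abelian varieties*, 7.5–7.7, 10.10.
* [Shimura1998] G. Shimura, *Abelian Varieties with Complex Multiplication and Modular Functions*, §8.4 Examples (1),
  (2)(C).
-/

noncomputable section

open CategoryTheory CategoryTheory.Limits NumberField NumberField.ComplexEmbedding IntermediateField Module
open scoped BigOperators

namespace Summit.HodgeConjecture.CorCM

open Literature.NumberTheory.ComplexMultiplication
open Literature.AlgebraicGeometry.Motives (AbelianVariety CMType)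
open Literature.AlgebraicGeometry.HodgeTheory
open Literature.AlgebraicGeometry.ComplexMultiplication (IsCMTypeRealisation isSimple_iff_isPrimitive)
open Literature.AlgebraicGeometry.VanGeemen1994 (hodgeClassSpan)
open Literature.AlgebraicGeometry.Pohlmann1968
open Literature.Barriers.HodgeConjecture (divisorClassesSpan)

/-! ## §1 Types -/

section Types

variable {I : Type} {K : I → Type} [∀ i, Field (K i)] [∀ i, NumberField (K i)] [∀ i, IsCMField (K i)] [Fintype I]
  [DecidableEq I]
variable {M : Type} [Field M] [NumberField M] [IsCMField M]

/-- **`K_S` non-Galois quartic inside an octic `K_F`: the pair is nondegenerate iff `Φ_F` is** — no proviso on `K_F`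
(a Galois `K_F` is the dihedral closure of `K_S`, without nondegenerate types). [cite: MoonenZarhin1999LowDim, "Hodge groups of simple abelian surfaces of CM-type"]
[cite: Shimura1998, §8.4 Examples (1), (2)(C)] -/
theorem isNondegenerateFamily_iff_of_quarticSubfield' {i₀ i₁ : I} (h01 : i₀ ≠ i₁) (hI : ∀ j, j = i₀ ∨ j = i₁)
    (Φ : ∀ i, CMType (K i)) (h4 : finrank ℚ (K i₀) = 4) (hK₀ : ¬ IsGalois ℚ (K i₀)) (e : K i₀ →+* K i₁)
    (h8 : finrank ℚ (K i₁) = 8) : CMAlgebra.IsNondegenerateFamily Φ ↔ IsNondegenerate (Φ i₁) := by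
  haveI : Nonempty I := ⟨i₀⟩
  by_cases hK₁ : IsGalois ℚ (K i₁)
  · have hΘ : ¬ IsNondegenerate (Φ i₁) := not_isNondegenerate_of_isGalois_of_ringHom h4 hK₀ h8 e (Φ i₁)
    exact ⟨fun hnd => absurd (hnd.isNondegenerate i₁) hΘ, fun h => absurd h hΘ⟩
  · exact isNondegenerateFamily_iff_of_quarticSubfield_of_not_isGalois h01 hI Φ h4 hK₀ e h8 hK₁

/-- **The reflex configuration: nondegenerate iff `Φ_F` is nondegenerate and `Stab(ψ₀)` moves `Φ_S`** — no proviso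
on `K_F` (`M` the other quartic class of `L_S`, `ψ₀ : M → ℂ` unsplit for `Φ_F`). [cite: MoonenZarhin1999LowDim, Thm. (0.2)]
[cite: Shimura1998, §8.3 Prop. 28 and §8.4 Example (2)(C)] -/
theorem isNondegenerateFamily_iff_of_reflexSubfield' {i₀ i₁ : I} (h01 : i₀ ≠ i₁) (hI : ∀ j, j = i₀ ∨ j = i₁)
    (Φ : ∀ i, CMType (K i)) (h4 : finrank ℚ (K i₀) = 4) (hK₀ : ¬ IsGalois ℚ (K i₀)) (h4M : finrank ℚ M = 4)
    (hM : ¬ IsGalois ℚ M) (hLL : normalClosure ℚ M ℂ = normalClosure ℚ (K i₀) ℂ) (e : M →+* K i₁)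
    (h8 : finrank ℚ (K i₁) = 8) {ψ₀ : M →+* ℂ}
    (hψ₀ : ∀ y y' : K i₁ →+* ℂ, y.comp e = ψ₀ → y'.comp e = ψ₀ → (y ∈ (Φ i₁).1 ↔ y' ∈ (Φ i₁).1)) :
    CMAlgebra.IsNondegenerateFamily Φ ↔ IsNondegenerate (Φ i₁) ∧
      ∃ h : ℂ ≃+* ℂ, h • ψ₀ = ψ₀ ∧ ∃ z : K i₀ →+* ℂ, ¬(h • z ∈ (Φ i₀).1 ↔ z ∈ (Φ i₀).1) := by
  haveI : Nonempty I := ⟨i₀⟩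
  by_cases hK₁ : IsGalois ℚ (K i₁)
  · have hΘ : ¬ IsNondegenerate (Φ i₁) := not_isNondegenerate_of_isGalois_of_ringHom h4M hM h8 e (Φ i₁)
    exact ⟨fun hnd => absurd (hnd.isNondegenerate i₁) hΘ, fun h => absurd h.1 hΘ⟩
  · exact isNondegenerateFamily_iff_of_reflexSubfield h01 hI Φ h4 hK₀ h4M hM hLL e h8 hK₁ hψ₀

end Types

/-! ## §2 On the varieties: simple `S` and `F` -/

section Geometry

variable {I : Type} {K : I → Type} [∀ i, Field (K i)] [∀ i, NumberField (K i)] [∀ i, IsCMField (K i)] [Fintype I]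
  [DecidableEq I] {Φ : ∀ i, CMType (K i)}
variable {A : I → AbelianVariety ℂ} {ι : ∀ i, 𝓞 (K i) →+* End (A i)}
  {θ : ∀ i, K i →+* Module.End ℂ (complexBetti (A i).X 1)}
variable {M : Type} [Field M] [NumberField M] [IsCMField M]

omit [∀ i, IsCMField (K i)] [Fintype I] [DecidableEq I] in
/-- Simple realisations of a quartic and an octic type form a separating family. [cite: Gordon1999HodgeAVSurvey, 7.4] -/
private theorem isSeparatingFamily_surface_fourfold {i₀ i₁ : I} (hI : ∀ j, j = i₀ ∨ j = i₁)
    (h4 : finrank ℚ (K i₀) = 4) (h8 : finrank ℚ (K i₁) = 8) (hA : ∀ i, IsCMTypeRealisation (Φ i) (A i) (ι i) (θ i))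
    (hs : ∀ i, (A i).IsSimple) : CMAlgebra.IsSeparatingFamily Φ := by
  refine isSeparatingFamily_of_isSimple_of_finrank_injective hA hs fun i j hij => ?_
  rcases hI i with rfl | rfl <;> rcases hI j with rfl | rfl
  · rfl
  · rw [h4, h8] at hij; omega
  · rw [h4, h8] at hij; omega
  · rfl

/-- **`S × F`, `S` a SIMPLE CM surface with non-Galois field `K_S`, `F` a SIMPLE CM fourfold with `K_S ⊂ K_F = End⁰(F)`:
`B• = D•` on ALL `S^a × F^b` iff the type of `F` is nondegenerate** — for every type of `S`, with no proviso on `K_F`.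
[cite: MoonenZarhin1999LowDim, Thm. (0.2)] [cite: Gordon1999HodgeAVSurvey, 7.5] -/
theorem forall_prod_hodgeClassSpan_eq_iff_surface_fourfold_of_subfield {i₀ i₁ : I} (h01 : i₀ ≠ i₁)
    (hI : ∀ j, j = i₀ ∨ j = i₁) (h4 : finrank ℚ (K i₀) = 4) (hK₀ : ¬ IsGalois ℚ (K i₀)) (e : K i₀ →+* K i₁)
    (h8 : finrank ℚ (K i₁) = 8) (hA : ∀ i, IsCMTypeRealisation (Φ i) (A i) (ι i) (θ i))
    (hs : ∀ i, (A i).IsSimple) :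
    (∀ (N : ℕ) (π : Fin N → I) (m : ℕ),
      hodgeClassSpan (⨁ fun j : Fin N => A (π j)).dim (⨁ fun j : Fin N => A (π j)).X m =
        divisorClassesSpan (⨁ fun j : Fin N => A (π j)).X (⨁ fun j : Fin N => A (π j)).dim m) ↔
      IsNondegenerate (Φ i₁) := by
  haveI : Nonempty I := ⟨i₀⟩
  rw [← CMAlgebra.isNondegenerateFamily_iff_forall_prod_hodgeClassSpan_eq
    (isSeparatingFamily_surface_fourfold hI h4 h8 hA hs) hA]
  exact isNondegenerateFamily_iff_of_quarticSubfield' h01 hI Φ h4 hK₀ e h8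

/-- **… and then the Hodge conjecture holds on every `S^a × F^b`** (any realisations, `Φ_F` nondegenerate).
[cite: Gordon1999HodgeAVSurvey, 7.5 and 10.10] -/
theorem hodgeConjectureFor_prod_surface_fourfold_of_subfield {i₀ i₁ : I} (h01 : i₀ ≠ i₁)
    (hI : ∀ j, j = i₀ ∨ j = i₁) (h4 : finrank ℚ (K i₀) = 4) (hK₀ : ¬ IsGalois ℚ (K i₀)) (e : K i₀ →+* K i₁)
    (h8 : finrank ℚ (K i₁) = 8) (hΦ₁ : IsNondegenerate (Φ i₁))
    (hA : ∀ i, IsCMTypeRealisation (Φ i) (A i) (ι i) (θ i)) {N : ℕ} (π : Fin N → I) :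
    HodgeConjectureFor (⨁ fun j : Fin N => A (π j)).dim (⨁ fun j : Fin N => A (π j)).X ∧
      ∀ m : ℕ, hodgeClassSpan (⨁ fun j : Fin N => A (π j)).dim (⨁ fun j : Fin N => A (π j)).X m =
        divisorClassesSpan (⨁ fun j : Fin N => A (π j)).X (⨁ fun j : Fin N => A (π j)).dim m :=
  haveI : Nonempty I := ⟨i₀⟩
  have hnd := (isNondegenerateFamily_iff_of_quarticSubfield' h01 hI Φ h4 hK₀ e h8).2 hΦ₁
  ⟨hnd.hodgeConjectureFor_prod hA π, fun m => hnd.hodgeClassSpan_prod_eq_divisorClassesSpan hA π m⟩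

/-- **`S × F` in the reflex configuration** (`S` SIMPLE with non-Galois `K_S`, `F` SIMPLE with `End⁰(F) = K_F ⊃ M`, `M`
the other quartic class of `L_S`, `ψ₀ : M → ℂ` unsplit for the type of `F`): `B• = D•` on ALL `S^a × F^b` iff the type
of `F` is nondegenerate and some automorphism of `ℂ` fixing `ψ₀` moves the type of `S` — a condition on the TYPE of
`S`: for `F` fixed, the surfaces of one complex-conjugacy class of types pass and those of the other carry exceptional
Hodge classes on some `S^a × F^b`. [cite: MoonenZarhin1999LowDim, Thm. (0.2)] [cite: Gordon1999HodgeAVSurvey, 7.5] -/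
theorem forall_prod_hodgeClassSpan_eq_iff_surface_fourfold_of_reflexSubfield {i₀ i₁ : I} (h01 : i₀ ≠ i₁)
    (hI : ∀ j, j = i₀ ∨ j = i₁) (h4 : finrank ℚ (K i₀) = 4) (hK₀ : ¬ IsGalois ℚ (K i₀)) (h4M : finrank ℚ M = 4)
    (hM : ¬ IsGalois ℚ M) (hLL : normalClosure ℚ M ℂ = normalClosure ℚ (K i₀) ℂ) (e : M →+* K i₁)
    (h8 : finrank ℚ (K i₁) = 8) {ψ₀ : M →+* ℂ}
    (hψ₀ : ∀ y y' : K i₁ →+* ℂ, y.comp e = ψ₀ → y'.comp e = ψ₀ → (y ∈ (Φ i₁).1 ↔ y' ∈ (Φ i₁).1))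
    (hA : ∀ i, IsCMTypeRealisation (Φ i) (A i) (ι i) (θ i)) (hs : ∀ i, (A i).IsSimple) :
    (∀ (N : ℕ) (π : Fin N → I) (m : ℕ),
      hodgeClassSpan (⨁ fun j : Fin N => A (π j)).dim (⨁ fun j : Fin N => A (π j)).X m =
        divisorClassesSpan (⨁ fun j : Fin N => A (π j)).X (⨁ fun j : Fin N => A (π j)).dim m) ↔
      IsNondegenerate (Φ i₁) ∧
        ∃ h : ℂ ≃+* ℂ, h • ψ₀ = ψ₀ ∧ ∃ z : K i₀ →+* ℂ, ¬(h • z ∈ (Φ i₀).1 ↔ z ∈ (Φ i₀).1) := by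
  haveI : Nonempty I := ⟨i₀⟩
  rw [← CMAlgebra.isNondegenerateFamily_iff_forall_prod_hodgeClassSpan_eq
    (isSeparatingFamily_surface_fourfold hI h4 h8 hA hs) hA]
  exact isNondegenerateFamily_iff_of_reflexSubfield' h01 hI Φ h4 hK₀ h4M hM hLL e h8 hψ₀

/-- **… and the Hodge conjecture on every `S^a × F^b` in the good conjugacy class.**
[cite: Gordon1999HodgeAVSurvey, 7.5 and 10.10] [cite: MoonenZarhin1999LowDim, Thm. (0.2) (4)] -/
theorem hodgeConjectureFor_prod_surface_fourfold_of_reflexSubfield {i₀ i₁ : I} (h01 : i₀ ≠ i₁)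
    (hI : ∀ j, j = i₀ ∨ j = i₁) (h4 : finrank ℚ (K i₀) = 4) (hK₀ : ¬ IsGalois ℚ (K i₀)) (h4M : finrank ℚ M = 4)
    (hM : ¬ IsGalois ℚ M) (hLL : normalClosure ℚ M ℂ = normalClosure ℚ (K i₀) ℂ) (e : M →+* K i₁)
    (h8 : finrank ℚ (K i₁) = 8) {ψ₀ : M →+* ℂ}
    (hψ₀ : ∀ y y' : K i₁ →+* ℂ, y.comp e = ψ₀ → y'.comp e = ψ₀ → (y ∈ (Φ i₁).1 ↔ y' ∈ (Φ i₁).1))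
    (hmove : ∃ h : ℂ ≃+* ℂ, h • ψ₀ = ψ₀ ∧ ∃ z : K i₀ →+* ℂ, ¬(h • z ∈ (Φ i₀).1 ↔ z ∈ (Φ i₀).1))
    (hΦ₁ : IsNondegenerate (Φ i₁)) (hA : ∀ i, IsCMTypeRealisation (Φ i) (A i) (ι i) (θ i)) {N : ℕ}
    (π : Fin N → I) :
    HodgeConjectureFor (⨁ fun j : Fin N => A (π j)).dim (⨁ fun j : Fin N => A (π j)).X ∧
      ∀ m : ℕ, hodgeClassSpan (⨁ fun j : Fin N => A (π j)).dim (⨁ fun j : Fin N => A (π j)).X m =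
        divisorClassesSpan (⨁ fun j : Fin N => A (π j)).X (⨁ fun j : Fin N => A (π j)).dim m :=
  haveI : Nonempty I := ⟨i₀⟩
  have hnd := (isNondegenerateFamily_iff_of_reflexSubfield' h01 hI Φ h4 hK₀ h4M hM hLL e h8 hψ₀).2 ⟨hΦ₁, hmove⟩
  ⟨hnd.hodgeConjectureFor_prod hA π, fun m => hnd.hodgeClassSpan_prod_eq_divisorClassesSpan hA π m⟩

end Geometry

end Summit.HodgeConjecture.CorCM

end
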